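import Summits.ABC.IUTFork.Repair.RHSigmaSlackAdapter
import HarnessLib

/-!
# R-H / D-0121 (T-OPTIMALITY, «netting ACROSS places»): THE CREDIT IS PAID ON THE CONE SIDE —
# `C(T) − R_∅(T) = PN Σᶠ logvol(ⁿ˚𝒰) − (−|log(q)|)`, hence `C(T) ≤ R_∅(T) + B + ((l+5)/4)·log π − T.gap` under the hull estimate with `B`

abc-iut cell, rung LADDER-ABC:A2.RESCUE.H, R-H seat abc-iut-rh2-q2-eq (gen 4). PROOF-ONLY sequel (0 definitions, 0 `Prop` facts, no instance, no notation)
of this seat's `RHSigmaLicenceSigned.lean` (p479556: `avg_cellDeficit_eq`, `negLogTheta_eq_coe`), `RHSigmaSignedRemainder.lean` (p480491: `credit`,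
`signedRemainder`, `D = R_∅ − C`) and `RHSigmaSlackAdapter.lean` (p484564: `cor312UpTo_signedRemainder_chosen`), with abc-iut-rh2-xi-1's squeeze
`RH.OffSigma.gap_le_of_cor312UpTo` (p469145) — answering rh-lead's D-0121 R30 (2026-08-27T02:52:47Z) items (3)/(4) («whatever is netted on the q-side
is charged on the cone side») BY A KERNEL THEOREM in the netting currency of record.

THE POINT. The credit `C(P) = PN Σᶠ (logvol ⁿ˚𝒰_c − qLocal_c)⁺` (`RH.SigmaLicence.credit`) that the single netted PN-sum of the weakened Corollary
forgoes (`statementUpTo_iff_debt_sub_credit_le`: `StatementUpTo P ε ⟺ R_∅ − C ≤ ε`) is HULL VOLUME: for every setting under the bridge hypotheses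
`C − R_∅ = PN Σᶠ logvol(ⁿ˚𝒰) − (−|log(q)|)` (§1, `credit_sub_offRemainder_empty_eq`), i.e. `−|log(Θ)|(P) = −|log(q)|(P) + (C − R_∅)`
(`negLogTheta_eq_coe_negLogQ_add_credit_sub`). So ANY upper bound `θ` on the setting's `−|log(Θ)|` — which is what the cone side of every abc /
exponent end of record demands ([CONE-C] `hregC`: `T.HullEstimateOf B` := `Σ_p ln μ̄(hull of the Θ-possible images) ≤ −deĝ_lgp(P_Θ) + B`, a bound on
HULL log-volumes, `Literature.IUT.LogVolume.ThetaVolumeInput.HullEstimateOf`) — caps the credit: `C ≤ R_∅ + (θ − (−|log(q)|))`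
(`credit_le_offRemainder_empty_add_of_negLogTheta_le`). At the CHOSEN bed of a genuine Θ-volume datum `T` (§2): the hull estimate with `B` gives
**`T.gap − B − ((l+5)/4)·log π ≤ D(T)`** (`gap_sub_le_signedRemainder_chosen_of_hullEstimateOf`; `D = R_∅ − C` the least slack) and
**`C(T) ≤ R_∅(T) + B + ((l+5)/4)·log π − T.gap`** (`credit_chosen_le_of_hullEstimateOf`); in particular «`ε = 0` by netting» (`D(T) ≤ 0`) at a datum
where the cone binder is granted forces print's own budget `T.gap ≤ B + ((l+5)/4)·log π` there (`gap_le_of_signedRemainder_chosen_nonpos_of_hullEstimateOf`),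
and on the `λ`-line `((l+1)/24 − 1/(2l))·log q^{∤{2,l}}(λ) ≤ B + D(T) + ((l+5)/4)·log π` (`logQAvoid_le_of_hullEstimateOf_signedRemainder_chosen`).
READING for the LP engines (R30 (2)/(4)): LP-2b's across-places credit is never free — each unit of credit netted on the q-side is a unit of hull
log-volume the [CONE-C] binder must pay for; netting moves the cost into [CONE-C], it does not remove it. The weighted twin
(`gap_le_weightedTrivialMass_add_of_weightedDeficit_nonpos_of_hullEstimateOf`) records the same for every weight scheme `ω ≤ 1` of the weighted door.

HONEST FRAMING: identities and inequalities about OUR typed objects; `T.HullEstimateOf B`, `weightedDeficit ≤ 0`, `D ≤ 0` are ASSUMPTION SHAPES, never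
asserted for any datum; nothing here asserts that abc is proved or refuted, or that [IUTchIII] Cor. 3.12 holds or fails at any datum, or takes a side on
any author (Mochizuki / Scholze–Stix / Joshi / Dupuy–Hilado); typed ≠ proved; instantiated ≠ endorsed. [claim: Mochizuki2012, status: disputed] for every
IUT locution. [cite: Mochizuki2012, IUTchIII Cor. 3.12 p. 173–174, Prop. 3.9 (i)(iii) p. 116; IUTchIV Thm. 1.10 Steps (v)–(x) p. 27–32]
[cite: DupuyHilado2025, §1 (1.1), §3.3, §3.9]
-/

noncomputable section

open Set Function NumberField IsDedekindDomain

/-! ## §1. Generic (any setting, bridge hypotheses): credit − debt = hull-volume functional − (−|log(q)|) -/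

namespace Summit.ABC.IUTFork.Repair.RH.SigmaLicence

open Summit.ABC.IUTFork.Thm311 Summit.ABC.IUTFork.Cor312 Summit.ABC.IUTFork.Cor312.Setting Summit.ABC.IUTFork.Cor312Vol
  Literature.IUT.LogThetaLattice Summit.ABC.IUTFork.Repair.RH.SigmaMass

variable {T : ThetaIndex} {S : Situation T} {P : Cor312.Setting S}

/-- **`D = −|log(q)| − PN Σᶠ logvol(ⁿ˚𝒰)`**: the signed remainder is the setting's `−|log(q)|` minus its hull-volume functional (p479556
`avg_cellDeficit_eq`, restated for the named number `signedRemainder`). [claim: Mochizuki2012, status: disputed] -/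
theorem signedRemainder_eq_negLogQ_sub_avg_logvol (H : BridgeHyps P) :
    signedRemainder P = P.negLogQ - processionNormalized fun i : Fin T.lstar =>
        ∑ᶠ vQ : T.VQ, (S.D P.n).logvol (labelSucc i) vQ (P.thetaHull (labelSucc i) vQ) := by
  unfold signedRemainder
  exact avg_cellDeficit_eq H

/-- `C − R_∅ = −D`. [claim: Mochizuki2012, status: disputed] -/
theorem credit_sub_offRemainder_empty_eq_neg_signedRemainder (H : BridgeHyps P) :
    credit P - offRemainder P ∅ = -signedRemainder P := by
  rw [signedRemainder_eq_offRemainder_empty_sub_credit H]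
  ring

/-- **THE CREDIT IS HULL VOLUME: `C − R_∅ = PN Σᶠ logvol(ⁿ˚𝒰) − (−|log(q)|)`.** Credit minus debt is the setting's hull-volume functional minus its
`q`-side; every unit of net credit is a unit of packet-hull log-volume. [claim: Mochizuki2012, status: disputed] -/
theorem credit_sub_offRemainder_empty_eq (H : BridgeHyps P) :
    credit P - offRemainder P ∅ =
      (processionNormalized fun i : Fin T.lstar =>
          ∑ᶠ vQ : T.VQ, (S.D P.n).logvol (labelSucc i) vQ (P.thetaHull (labelSucc i) vQ)) - P.negLogQ := by
  rw [credit_sub_offRemainder_empty_eq_neg_signedRemainder H, signedRemainder_eq_negLogQ_sub_avg_logvol H]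
  ring

/-- **`−|log(Θ)|(P) = −|log(q)|(P) + (C − R_∅)`** (as an element of `WithTop ℝ`; finite under the bridge hypotheses). [claim: Mochizuki2012, status: disputed] -/
theorem negLogTheta_eq_coe_negLogQ_add_credit_sub (H : BridgeHyps P) :
    P.negLogTheta = ((P.negLogQ + (credit P - offRemainder P ∅) : ℝ) : WithTop ℝ) := by
  rw [negLogTheta_eq_coe H, credit_sub_offRemainder_empty_eq H]
  congr 1
  ring

/-- **ANY CONE-SIDE BOUND CAPS THE NET CREDIT**: if the setting's `−|log(Θ)|` is at most `θ`, then `C − R_∅ ≤ θ − (−|log(q)|)`.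
[claim: Mochizuki2012, status: disputed] -/
theorem credit_sub_offRemainder_empty_le_of_negLogTheta_le (H : BridgeHyps P) {θ : ℝ}
    (hθ : P.negLogTheta ≤ ((θ : ℝ) : WithTop ℝ)) : credit P - offRemainder P ∅ ≤ θ - P.negLogQ := by
  rw [negLogTheta_eq_coe_negLogQ_add_credit_sub H, WithTop.coe_le_coe] at hθ
  linarith

/-- The same as a ceiling on the credit: `C ≤ R_∅ + (θ − (−|log(q)|))`. [claim: Mochizuki2012, status: disputed] -/
theorem credit_le_offRemainder_empty_add_of_negLogTheta_le (H : BridgeHyps P) {θ : ℝ}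
    (hθ : P.negLogTheta ≤ ((θ : ℝ) : WithTop ℝ)) : credit P ≤ offRemainder P ∅ + (θ - P.negLogQ) := by
  have h := credit_sub_offRemainder_empty_le_of_negLogTheta_le H hθ
  linarith

/-- The same as a floor on the least slack: `−|log(q)| − θ ≤ D`. [claim: Mochizuki2012, status: disputed] -/
theorem negLogQ_sub_le_signedRemainder_of_negLogTheta_le (H : BridgeHyps P) {θ : ℝ}
    (hθ : P.negLogTheta ≤ ((θ : ℝ) : WithTop ℝ)) : P.negLogQ - θ ≤ signedRemainder P := by
  have h := credit_sub_offRemainder_empty_le_of_negLogTheta_le H hθ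
  rw [credit_sub_offRemainder_empty_eq_neg_signedRemainder H] at h
  linarith

/-- Conversely the least slack never exceeds `−|log(q)| − θ'` for any MINORANT `θ'` of the setting's `−|log(Θ)|`. [claim: Mochizuki2012, status: disputed] -/
theorem signedRemainder_le_negLogQ_sub_of_le_negLogTheta (H : BridgeHyps P) {θ' : ℝ}
    (hθ : ((θ' : ℝ) : WithTop ℝ) ≤ P.negLogTheta) : signedRemainder P ≤ P.negLogQ - θ' := by
  rw [negLogTheta_eq_coe_negLogQ_add_credit_sub H, WithTop.coe_le_coe] at hθ
  rw [← neg_neg (signedRemainder P), ← credit_sub_offRemainder_empty_eq_neg_signedRemainder H]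
  linarith

end Summit.ABC.IUTFork.Repair.RH.SigmaLicence

/-! ## §2. T-LEVEL at the CHOSEN realising ideles: the hull estimate with `B` floors `D(T)` and caps `C(T)` -/

namespace Summit.ABC.IUTFork.Repair.RH.SigmaStrataEq

open Summit.ABC.IUTFork.Thm311 Summit.ABC.IUTFork.Thm311.Real Summit.ABC.IUTFork.Cor312 Summit.ABC.IUTFork.Cor312.Setting
  Summit.ABC.IUTFork.Cor312Vol Summit.ABC.IUTFork.Cor312Prov Literature.IUT.LogThetaLattice Literature.IUT.LogVolume
  Literature.IUT.HodgeTheaters Literature.IUT.LogVolume.ThetaData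
  Summit.ABC.IUTFork.Repair.RH.SigmaLicence Summit.ABC.IUTFork.Repair.RH.SigmaMass

section Chosen

open Literature.NumberTheory.DiophantineGeometry.GenEll Summit.ABC.ABC.Theorems Summit.ABC.IUTFork.Conditional

/-- **THE CONE FLOORS THE LEAST SLACK: `T.gap − B − ((l+5)/4)·log π ≤ D(T)`.** At the chosen bed of EVERY genuine Θ-volume datum `T` of `(P, l)`, the hull
estimate with `B` (`T.HullEstimateOf B` — the CONSEQUENT of the [CONE-C] binder `hregC` of every exponent end of record, an upper bound on HULL
log-volumes) and the hypothesis-free `T.negAbsLogQ ≤ T.negLogTheta + D(T)` (p484564 `cor312UpTo_signedRemainder_chosen`) give, by abc-iut-rh2-xi-1's squeeze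
`RH.OffSigma.gap_le_of_cor312UpTo`, `T.gap ≤ B + D(T) + ((l+5)/4)·log π`. The hull estimate is an ASSUMPTION SHAPE; no side taken.
[cite: Mochizuki2012, IUTchIV Thm. 1.10 Steps (v)–(x) p. 27–32] [claim: Mochizuki2012, status: disputed] -/
theorem gap_sub_le_signedRemainder_chosen_of_hullEstimateOf {P : NFPoint} {l : ℕ} (T : Cor22.ThetaVolumeDatumAt P l) :
    letI := T.instFieldF; letI := T.instNumberFieldF; letI := T.instAlgebraF; letI := T.instFieldK;
        letI := T.instNumberFieldK; letI := T.instAlgebraK; letI := T.instFieldFbar; letI := T.instAlgebraFbar;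
        letI := T.instAlgebraKFbar; letI := T.instIsElliptic;
    ∀ (M : Type) [Field M] [NumberField M]
      (archPk : ∀ (j : (thetaIndex (pilotDataOfK T.D T.K)).Label) (vQ : (thetaIndex (pilotDataOfK T.D T.K)).VQ),
        Set ((logShellsDH (pilotDataOfK T.D T.K) (analyticLogv T.K)).Packet j vQ))
      (archSub : ∀ (j : (thetaIndex (pilotDataOfK T.D T.K)).Label) (v : (thetaIndex (pilotDataOfK T.D T.K)).V),
        Set ((logShellsDH (pilotDataOfK T.D T.K) (analyticLogv T.K)).Packet j ((thetaIndex (pilotDataOfK T.D T.K)).over v)))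
      (Ψ : ℤ → ∀ v : (thetaIndex (pilotDataOfK T.D T.K)).V, v ∈ (thetaIndex (pilotDataOfK T.D T.K)).Vbad →
        Set ((logShellsDH (pilotDataOfK T.D T.K) (analyticLogv T.K)).StarPacket v))
      (act : ℤ → ∀ v : (thetaIndex (pilotDataOfK T.D T.K)).V, v ∈ (thetaIndex (pilotDataOfK T.D T.K)).Vbad →
        (logShellsDH (pilotDataOfK T.D T.K) (analyticLogv T.K)).StarPacket v →
          Module.End ℚ ((logShellsDH (pilotDataOfK T.D T.K) (analyticLogv T.K)).StarPacket v))
      (Mmod : ℤ → ∀ j : (thetaIndex (pilotDataOfK T.D T.K)).LabelStar,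
        Set ((logShellsDH (pilotDataOfK T.D T.K) (analyticLogv T.K)).GlobalPacket j.1))
      (region : ℤ → ∀ j : (thetaIndex (pilotDataOfK T.D T.K)).LabelStar, FinDivisor M →
        ∀ vQ : (thetaIndex (pilotDataOfK T.D T.K)).VQ, Set ((logShellsDH (pilotDataOfK T.D T.K) (analyticLogv T.K)).Packet j.1 vQ))
      (n : ℤ) {HT : Type} {LogLink : HT → HT → Type} {IsFull : ∀ {s t : HT}, LogLink s t → Prop}
      (lat : LGPGaussianLogThetaLattice LogLink IsFull)
      {Frd : Type} {IsoF : Frd → Frd → Type} {Ob : Frd → Type} {realify : Frd → Frd} {Strip : Type}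
      {IsoS : Strip → Strip → Type}
      {Mv : ∀ v : (thetaIndex (pilotDataOfK T.D T.K)).V, v ∈ (thetaIndex (pilotDataOfK T.D T.K)).Vbad → Type}
      [∀ v h, Monoid (Mv v h)]
      (sig : GlobalLGPFrobenioidSignature (thetaIndex (pilotDataOfK T.D T.K)).lstar (thetaIndex (pilotDataOfK T.D T.K)).V
        (· ∈ (thetaIndex (pilotDataOfK T.D T.K)).Vbad) Frd IsoF Ob realify Strip IsoS Mv)
      (split : SplittingMonoids Mv) {ObΔ : Type}
      {N : ∀ v : (thetaIndex (pilotDataOfK T.D T.K)).V, v ∈ (thetaIndex (pilotDataOfK T.D T.K)).Vbad → Type} [∀ v h, Monoid (N v h)]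
      (qData : QPilotData ObΔ N) {B : ℝ}, T.HullEstimateOf B →
      T.gap - B - ThetaVolumeInput.archLogTheta l ≤
        signedRemainder
          (settingPrVolSharp (pilotDataOfK T.D T.K) (logvAnalytic_analyticLogv (F := T.K)) M archPk archSub Ψ act Mmod region n lat
            sig split qData (exists_realising_qIdeles_pilotDataOfK T.D).choose (exists_realising_thetaIdeles_pilotDataOfK T.D).choose
            (exists_realising_qIdeles_pilotDataOfK T.D).choose_spec.1 (exists_realising_qIdeles_pilotDataOfK T.D).choose_spec.2.1) := by
  intro M _ _ archPk archSub Ψ act Mmod region n HT LogLink IsFull lat Frd IsoF Ob realify Strip IsoS Mv _ sig split ObΔ N _ qData B hB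
  letI := T.instFieldF; letI := T.instNumberFieldF; letI := T.instAlgebraF; letI := T.instFieldK
  letI := T.instNumberFieldK; letI := T.instAlgebraK; letI := T.instFieldFbar; letI := T.instAlgebraFbar
  letI := T.instAlgebraKFbar; letI := T.instIsElliptic
  have h := cor312UpTo_signedRemainder_chosen T M archPk archSub Ψ act Mmod region n lat sig split qData
  have hg := RH.OffSigma.gap_le_of_cor312UpTo T
    (B := signedRemainder
      (settingPrVolSharp (pilotDataOfK T.D T.K) (logvAnalytic_analyticLogv (F := T.K)) M archPk archSub Ψ act Mmod region n lat
        sig split qData (exists_realising_qIdeles_pilotDataOfK T.D).choose (exists_realising_thetaIdeles_pilotDataOfK T.D).choose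
        (exists_realising_qIdeles_pilotDataOfK T.D).choose_spec.1 (exists_realising_qIdeles_pilotDataOfK T.D).choose_spec.2.1))
    (δ := B) (by linarith) hB
  linarith

/-- **THE CONE CAPS THE CREDIT: `C(T) ≤ R_∅(T) + B + ((l+5)/4)·log π − T.gap`** at the chosen bed of every genuine Θ-volume datum carrying the hull estimate
with `B` (`D = R_∅ − C`, p480491). Each unit of credit netted on the `q`-side is a unit of hull log-volume the cone binder pays for: an across-places
netting certificate with credit `C` and the [CONE-C] binder are COUPLED by this inequality. ASSUMPTION SHAPE; no side taken.
[cite: Mochizuki2012, IUTchIV Thm. 1.10 Steps (v)–(x) p. 27–32] [claim: Mochizuki2012, status: disputed] -/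
theorem credit_chosen_le_of_hullEstimateOf {P : NFPoint} {l : ℕ} (T : Cor22.ThetaVolumeDatumAt P l) :
    letI := T.instFieldF; letI := T.instNumberFieldF; letI := T.instAlgebraF; letI := T.instFieldK;
        letI := T.instNumberFieldK; letI := T.instAlgebraK; letI := T.instFieldFbar; letI := T.instAlgebraFbar;
        letI := T.instAlgebraKFbar; letI := T.instIsElliptic;
    ∀ (M : Type) [Field M] [NumberField M]
      (archPk : ∀ (j : (thetaIndex (pilotDataOfK T.D T.K)).Label) (vQ : (thetaIndex (pilotDataOfK T.D T.K)).VQ),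
        Set ((logShellsDH (pilotDataOfK T.D T.K) (analyticLogv T.K)).Packet j vQ))
      (archSub : ∀ (j : (thetaIndex (pilotDataOfK T.D T.K)).Label) (v : (thetaIndex (pilotDataOfK T.D T.K)).V),
        Set ((logShellsDH (pilotDataOfK T.D T.K) (analyticLogv T.K)).Packet j ((thetaIndex (pilotDataOfK T.D T.K)).over v)))
      (Ψ : ℤ → ∀ v : (thetaIndex (pilotDataOfK T.D T.K)).V, v ∈ (thetaIndex (pilotDataOfK T.D T.K)).Vbad →
        Set ((logShellsDH (pilotDataOfK T.D T.K) (analyticLogv T.K)).StarPacket v))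
      (act : ℤ → ∀ v : (thetaIndex (pilotDataOfK T.D T.K)).V, v ∈ (thetaIndex (pilotDataOfK T.D T.K)).Vbad →
        (logShellsDH (pilotDataOfK T.D T.K) (analyticLogv T.K)).StarPacket v →
          Module.End ℚ ((logShellsDH (pilotDataOfK T.D T.K) (analyticLogv T.K)).StarPacket v))
      (Mmod : ℤ → ∀ j : (thetaIndex (pilotDataOfK T.D T.K)).LabelStar,
        Set ((logShellsDH (pilotDataOfK T.D T.K) (analyticLogv T.K)).GlobalPacket j.1))
      (region : ℤ → ∀ j : (thetaIndex (pilotDataOfK T.D T.K)).LabelStar, FinDivisor M →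
        ∀ vQ : (thetaIndex (pilotDataOfK T.D T.K)).VQ, Set ((logShellsDH (pilotDataOfK T.D T.K) (analyticLogv T.K)).Packet j.1 vQ))
      (n : ℤ) {HT : Type} {LogLink : HT → HT → Type} {IsFull : ∀ {s t : HT}, LogLink s t → Prop}
      (lat : LGPGaussianLogThetaLattice LogLink IsFull)
      {Frd : Type} {IsoF : Frd → Frd → Type} {Ob : Frd → Type} {realify : Frd → Frd} {Strip : Type}
      {IsoS : Strip → Strip → Type}
      {Mv : ∀ v : (thetaIndex (pilotDataOfK T.D T.K)).V, v ∈ (thetaIndex (pilotDataOfK T.D T.K)).Vbad → Type}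
      [∀ v h, Monoid (Mv v h)]
      (sig : GlobalLGPFrobenioidSignature (thetaIndex (pilotDataOfK T.D T.K)).lstar (thetaIndex (pilotDataOfK T.D T.K)).V
        (· ∈ (thetaIndex (pilotDataOfK T.D T.K)).Vbad) Frd IsoF Ob realify Strip IsoS Mv)
      (split : SplittingMonoids Mv) {ObΔ : Type}
      {N : ∀ v : (thetaIndex (pilotDataOfK T.D T.K)).V, v ∈ (thetaIndex (pilotDataOfK T.D T.K)).Vbad → Type} [∀ v h, Monoid (N v h)]
      (qData : QPilotData ObΔ N) {B : ℝ}, T.HullEstimateOf B →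
      credit
          (settingPrVolSharp (pilotDataOfK T.D T.K) (logvAnalytic_analyticLogv (F := T.K)) M archPk archSub Ψ act Mmod region n lat
            sig split qData (exists_realising_qIdeles_pilotDataOfK T.D).choose (exists_realising_thetaIdeles_pilotDataOfK T.D).choose
            (exists_realising_qIdeles_pilotDataOfK T.D).choose_spec.1 (exists_realising_qIdeles_pilotDataOfK T.D).choose_spec.2.1) ≤
        offRemainder
          (settingPrVolSharp (pilotDataOfK T.D T.K) (logvAnalytic_analyticLogv (F := T.K)) M archPk archSub Ψ act Mmod region n lat
            sig split qData (exists_realising_qIdeles_pilotDataOfK T.D).choose (exists_realising_thetaIdeles_pilotDataOfK T.D).choose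
            (exists_realising_qIdeles_pilotDataOfK T.D).choose_spec.1 (exists_realising_qIdeles_pilotDataOfK T.D).choose_spec.2.1) ∅ +
          B + ThetaVolumeInput.archLogTheta l - T.gap := by
  intro M _ _ archPk archSub Ψ act Mmod region n HT LogLink IsFull lat Frd IsoF Ob realify Strip IsoS Mv _ sig split ObΔ N _ qData B hB
  letI := T.instFieldF; letI := T.instNumberFieldF; letI := T.instAlgebraF; letI := T.instFieldK
  letI := T.instNumberFieldK; letI := T.instAlgebraK; letI := T.instFieldFbar; letI := T.instAlgebraFbar
  letI := T.instAlgebraKFbar; letI := T.instIsElliptic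
  have H := bridgeHyps_settingPrVolSharp_of_ideles (pilotDataOfK T.D T.K) (logvAnalytic_analyticLogv (F := T.K)) M archPk archSub Ψ act
    Mmod region n lat sig split qData (exists_realising_thetaIdeles_pilotDataOfK T.D).choose (exists_realising_qIdeles_pilotDataOfK T.D).choose
    (exists_realising_thetaIdeles_pilotDataOfK T.D).choose_spec.1 (exists_realising_thetaIdeles_pilotDataOfK T.D).choose_spec.2.1
    (exists_realising_qIdeles_pilotDataOfK T.D).choose_spec.1 (exists_realising_qIdeles_pilotDataOfK T.D).choose_spec.2.1
  have h := gap_sub_le_signedRemainder_chosen_of_hullEstimateOf T M archPk archSub Ψ act Mmod region n lat sig split qData hB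
  rw [signedRemainder_eq_offRemainder_empty_sub_credit H] at h
  linarith

/-- **«ε = 0 BY NETTING» FORCES PRINT'S BUDGET: `D(T) ≤ 0 ∧ T.HullEstimateOf B ⟹ T.gap ≤ B + ((l+5)/4)·log π`.** If at a datum the netted slack is
non-positive (credit ≥ debt, i.e. the printed Statement of the chosen setting, `statement_iff_signedRemainder_nonpos`) and the cone binder is granted with
`B`, then the datum's gap is within print's budget — the netting has moved the whole cost into the cone binder. ASSUMPTION SHAPES; no side taken.
[cite: Mochizuki2012, IUTchIV Thm. 1.10 Steps (v)–(x) p. 27–32] [claim: Mochizuki2012, status: disputed] -/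
theorem gap_le_of_signedRemainder_chosen_nonpos_of_hullEstimateOf {P : NFPoint} {l : ℕ} (T : Cor22.ThetaVolumeDatumAt P l) :
    letI := T.instFieldF; letI := T.instNumberFieldF; letI := T.instAlgebraF; letI := T.instFieldK;
        letI := T.instNumberFieldK; letI := T.instAlgebraK; letI := T.instFieldFbar; letI := T.instAlgebraFbar;
        letI := T.instAlgebraKFbar; letI := T.instIsElliptic;
    ∀ (M : Type) [Field M] [NumberField M]
      (archPk : ∀ (j : (thetaIndex (pilotDataOfK T.D T.K)).Label) (vQ : (thetaIndex (pilotDataOfK T.D T.K)).VQ),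
        Set ((logShellsDH (pilotDataOfK T.D T.K) (analyticLogv T.K)).Packet j vQ))
      (archSub : ∀ (j : (thetaIndex (pilotDataOfK T.D T.K)).Label) (v : (thetaIndex (pilotDataOfK T.D T.K)).V),
        Set ((logShellsDH (pilotDataOfK T.D T.K) (analyticLogv T.K)).Packet j ((thetaIndex (pilotDataOfK T.D T.K)).over v)))
      (Ψ : ℤ → ∀ v : (thetaIndex (pilotDataOfK T.D T.K)).V, v ∈ (thetaIndex (pilotDataOfK T.D T.K)).Vbad →
        Set ((logShellsDH (pilotDataOfK T.D T.K) (analyticLogv T.K)).StarPacket v))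
      (act : ℤ → ∀ v : (thetaIndex (pilotDataOfK T.D T.K)).V, v ∈ (thetaIndex (pilotDataOfK T.D T.K)).Vbad →
        (logShellsDH (pilotDataOfK T.D T.K) (analyticLogv T.K)).StarPacket v →
          Module.End ℚ ((logShellsDH (pilotDataOfK T.D T.K) (analyticLogv T.K)).StarPacket v))
      (Mmod : ℤ → ∀ j : (thetaIndex (pilotDataOfK T.D T.K)).LabelStar,
        Set ((logShellsDH (pilotDataOfK T.D T.K) (analyticLogv T.K)).GlobalPacket j.1))
      (region : ℤ → ∀ j : (thetaIndex (pilotDataOfK T.D T.K)).LabelStar, FinDivisor M →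
        ∀ vQ : (thetaIndex (pilotDataOfK T.D T.K)).VQ, Set ((logShellsDH (pilotDataOfK T.D T.K) (analyticLogv T.K)).Packet j.1 vQ))
      (n : ℤ) {HT : Type} {LogLink : HT → HT → Type} {IsFull : ∀ {s t : HT}, LogLink s t → Prop}
      (lat : LGPGaussianLogThetaLattice LogLink IsFull)
      {Frd : Type} {IsoF : Frd → Frd → Type} {Ob : Frd → Type} {realify : Frd → Frd} {Strip : Type}
      {IsoS : Strip → Strip → Type}
      {Mv : ∀ v : (thetaIndex (pilotDataOfK T.D T.K)).V, v ∈ (thetaIndex (pilotDataOfK T.D T.K)).Vbad → Type}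
      [∀ v h, Monoid (Mv v h)]
      (sig : GlobalLGPFrobenioidSignature (thetaIndex (pilotDataOfK T.D T.K)).lstar (thetaIndex (pilotDataOfK T.D T.K)).V
        (· ∈ (thetaIndex (pilotDataOfK T.D T.K)).Vbad) Frd IsoF Ob realify Strip IsoS Mv)
      (split : SplittingMonoids Mv) {ObΔ : Type}
      {N : ∀ v : (thetaIndex (pilotDataOfK T.D T.K)).V, v ∈ (thetaIndex (pilotDataOfK T.D T.K)).Vbad → Type} [∀ v h, Monoid (N v h)]
      (qData : QPilotData ObΔ N) {B : ℝ},
      signedRemainder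
          (settingPrVolSharp (pilotDataOfK T.D T.K) (logvAnalytic_analyticLogv (F := T.K)) M archPk archSub Ψ act Mmod region n lat
            sig split qData (exists_realising_qIdeles_pilotDataOfK T.D).choose (exists_realising_thetaIdeles_pilotDataOfK T.D).choose
            (exists_realising_qIdeles_pilotDataOfK T.D).choose_spec.1 (exists_realising_qIdeles_pilotDataOfK T.D).choose_spec.2.1) ≤ 0 →
      T.HullEstimateOf B → T.gap ≤ B + ThetaVolumeInput.archLogTheta l := by
  intro M _ _ archPk archSub Ψ act Mmod region n HT LogLink IsFull lat Frd IsoF Ob realify Strip IsoS Mv _ sig split ObΔ N _ qData B hD hB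
  letI := T.instFieldF; letI := T.instNumberFieldF; letI := T.instAlgebraF; letI := T.instFieldK
  letI := T.instNumberFieldK; letI := T.instAlgebraK; letI := T.instFieldFbar; letI := T.instAlgebraFbar
  letI := T.instAlgebraKFbar; letI := T.instIsElliptic
  have h := gap_sub_le_signedRemainder_chosen_of_hullEstimateOf T M archPk archSub Ψ act Mmod region n lat sig split qData hB
  linarith

/-- **ON THE `λ`-LINE: `((l+1)/24 − 1/(2l))·log q^{∤{2,l}}(λ) ≤ B + D(T) + ((l+5)/4)·log π`** for `λ ∈ U_P` (minimally presented) — abc-iut-rh2-xi-1's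
`RH.OffSigma.logQAvoid_le_of_cor312UpTo` with the `B` of «Cor. 3.12 up to `B`» DISCHARGED by the least slack `D(T)`: whatever netting certifies, the
`log(q)`-gap of [IUTchIV] Cor. 2.2 (ii) must still be covered by `B + D(T) +` the archimedean term. ASSUMPTION SHAPE (`T.HullEstimateOf B`); no side taken.
[cite: Mochizuki2012, IUTchIV Thm. 1.10 Steps (viii)–(x) p. 30–32; Cor. 2.2 (ii) proof p. 46] [claim: Mochizuki2012, status: disputed] -/
theorem logQAvoid_le_of_hullEstimateOf_signedRemainder_chosen {P : NFPoint} {l : ℕ} (T : Cor22.ThetaVolumeDatumAt P l) (hU : P.InU) :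
    letI := T.instFieldF; letI := T.instNumberFieldF; letI := T.instAlgebraF; letI := T.instFieldK;
        letI := T.instNumberFieldK; letI := T.instAlgebraK; letI := T.instFieldFbar; letI := T.instAlgebraFbar;
        letI := T.instAlgebraKFbar; letI := T.instIsElliptic;
    ∀ (M : Type) [Field M] [NumberField M]
      (archPk : ∀ (j : (thetaIndex (pilotDataOfK T.D T.K)).Label) (vQ : (thetaIndex (pilotDataOfK T.D T.K)).VQ),
        Set ((logShellsDH (pilotDataOfK T.D T.K) (analyticLogv T.K)).Packet j vQ))
      (archSub : ∀ (j : (thetaIndex (pilotDataOfK T.D T.K)).Label) (v : (thetaIndex (pilotDataOfK T.D T.K)).V),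
        Set ((logShellsDH (pilotDataOfK T.D T.K) (analyticLogv T.K)).Packet j ((thetaIndex (pilotDataOfK T.D T.K)).over v)))
      (Ψ : ℤ → ∀ v : (thetaIndex (pilotDataOfK T.D T.K)).V, v ∈ (thetaIndex (pilotDataOfK T.D T.K)).Vbad →
        Set ((logShellsDH (pilotDataOfK T.D T.K) (analyticLogv T.K)).StarPacket v))
      (act : ℤ → ∀ v : (thetaIndex (pilotDataOfK T.D T.K)).V, v ∈ (thetaIndex (pilotDataOfK T.D T.K)).Vbad →
        (logShellsDH (pilotDataOfK T.D T.K) (analyticLogv T.K)).StarPacket v →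
          Module.End ℚ ((logShellsDH (pilotDataOfK T.D T.K) (analyticLogv T.K)).StarPacket v))
      (Mmod : ℤ → ∀ j : (thetaIndex (pilotDataOfK T.D T.K)).LabelStar,
        Set ((logShellsDH (pilotDataOfK T.D T.K) (analyticLogv T.K)).GlobalPacket j.1))
      (region : ℤ → ∀ j : (thetaIndex (pilotDataOfK T.D T.K)).LabelStar, FinDivisor M →
        ∀ vQ : (thetaIndex (pilotDataOfK T.D T.K)).VQ, Set ((logShellsDH (pilotDataOfK T.D T.K) (analyticLogv T.K)).Packet j.1 vQ))
      (n : ℤ) {HT : Type} {LogLink : HT → HT → Type} {IsFull : ∀ {s t : HT}, LogLink s t → Prop}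
      (lat : LGPGaussianLogThetaLattice LogLink IsFull)
      {Frd : Type} {IsoF : Frd → Frd → Type} {Ob : Frd → Type} {realify : Frd → Frd} {Strip : Type}
      {IsoS : Strip → Strip → Type}
      {Mv : ∀ v : (thetaIndex (pilotDataOfK T.D T.K)).V, v ∈ (thetaIndex (pilotDataOfK T.D T.K)).Vbad → Type}
      [∀ v h, Monoid (Mv v h)]
      (sig : GlobalLGPFrobenioidSignature (thetaIndex (pilotDataOfK T.D T.K)).lstar (thetaIndex (pilotDataOfK T.D T.K)).V
        (· ∈ (thetaIndex (pilotDataOfK T.D T.K)).Vbad) Frd IsoF Ob realify Strip IsoS Mv)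
      (split : SplittingMonoids Mv) {ObΔ : Type}
      {N : ∀ v : (thetaIndex (pilotDataOfK T.D T.K)).V, v ∈ (thetaIndex (pilotDataOfK T.D T.K)).Vbad → Type} [∀ v h, Monoid (N v h)]
      (qData : QPilotData ObΔ N) {B : ℝ}, T.HullEstimateOf B →
      (((l : ℝ) + 1) / 24 - 1 / (2 * l)) * Cor22.logQAvoid P {2, l} ≤
        B + signedRemainder
          (settingPrVolSharp (pilotDataOfK T.D T.K) (logvAnalytic_analyticLogv (F := T.K)) M archPk archSub Ψ act Mmod region n lat
            sig split qData (exists_realising_qIdeles_pilotDataOfK T.D).choose (exists_realising_thetaIdeles_pilotDataOfK T.D).choose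
            (exists_realising_qIdeles_pilotDataOfK T.D).choose_spec.1 (exists_realising_qIdeles_pilotDataOfK T.D).choose_spec.2.1) +
          ThetaVolumeInput.archLogTheta l := by
  intro M _ _ archPk archSub Ψ act Mmod region n HT LogLink IsFull lat Frd IsoF Ob realify Strip IsoS Mv _ sig split ObΔ N _ qData B hB
  letI := T.instFieldF; letI := T.instNumberFieldF; letI := T.instAlgebraF; letI := T.instFieldK
  letI := T.instNumberFieldK; letI := T.instAlgebraK; letI := T.instFieldFbar; letI := T.instAlgebraFbar
  letI := T.instAlgebraKFbar; letI := T.instIsElliptic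
  have h := cor312UpTo_signedRemainder_chosen T M archPk archSub Ψ act Mmod region n lat sig split qData
  exact RH.OffSigma.logQAvoid_le_of_cor312UpTo T hU (by linarith) hB

/-- **WEIGHTED TWIN: every weight scheme pays the cone too.** At the chosen bed, a weight `ω ≤ 1` with `weightedDeficit ω ≤ 0` (THE WEIGHTED DOOR's
hypotheses, p480491) and the hull estimate with `B` give `T.gap ≤ weightedTrivialMass ω + B + ((l+5)/4)·log π`: the (1−ω)-charged trivial mass plus the
cone budget must cover the gap, for EVERY averaging scheme. ASSUMPTION SHAPES; no side taken.
[cite: Mochizuki2012, IUTchIV Thm. 1.10 Steps (v)–(x) p. 27–32] [claim: Mochizuki2012, status: disputed] -/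
theorem gap_le_weightedTrivialMass_add_of_weightedDeficit_nonpos_of_hullEstimateOf {P : NFPoint} {l : ℕ}
    (T : Cor22.ThetaVolumeDatumAt P l) :
    letI := T.instFieldF; letI := T.instNumberFieldF; letI := T.instAlgebraF; letI := T.instFieldK;
        letI := T.instNumberFieldK; letI := T.instAlgebraK; letI := T.instFieldFbar; letI := T.instAlgebraFbar;
        letI := T.instAlgebraKFbar; letI := T.instIsElliptic;
    ∀ (M : Type) [Field M] [NumberField M]
      (archPk : ∀ (j : (thetaIndex (pilotDataOfK T.D T.K)).Label) (vQ : (thetaIndex (pilotDataOfK T.D T.K)).VQ),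
        Set ((logShellsDH (pilotDataOfK T.D T.K) (analyticLogv T.K)).Packet j vQ))
      (archSub : ∀ (j : (thetaIndex (pilotDataOfK T.D T.K)).Label) (v : (thetaIndex (pilotDataOfK T.D T.K)).V),
        Set ((logShellsDH (pilotDataOfK T.D T.K) (analyticLogv T.K)).Packet j ((thetaIndex (pilotDataOfK T.D T.K)).over v)))
      (Ψ : ℤ → ∀ v : (thetaIndex (pilotDataOfK T.D T.K)).V, v ∈ (thetaIndex (pilotDataOfK T.D T.K)).Vbad →
        Set ((logShellsDH (pilotDataOfK T.D T.K) (analyticLogv T.K)).StarPacket v))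
      (act : ℤ → ∀ v : (thetaIndex (pilotDataOfK T.D T.K)).V, v ∈ (thetaIndex (pilotDataOfK T.D T.K)).Vbad →
        (logShellsDH (pilotDataOfK T.D T.K) (analyticLogv T.K)).StarPacket v →
          Module.End ℚ ((logShellsDH (pilotDataOfK T.D T.K) (analyticLogv T.K)).StarPacket v))
      (Mmod : ℤ → ∀ j : (thetaIndex (pilotDataOfK T.D T.K)).LabelStar,
        Set ((logShellsDH (pilotDataOfK T.D T.K) (analyticLogv T.K)).GlobalPacket j.1))
      (region : ℤ → ∀ j : (thetaIndex (pilotDataOfK T.D T.K)).LabelStar, FinDivisor M →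
        ∀ vQ : (thetaIndex (pilotDataOfK T.D T.K)).VQ, Set ((logShellsDH (pilotDataOfK T.D T.K) (analyticLogv T.K)).Packet j.1 vQ))
      (n : ℤ) {HT : Type} {LogLink : HT → HT → Type} {IsFull : ∀ {s t : HT}, LogLink s t → Prop}
      (lat : LGPGaussianLogThetaLattice LogLink IsFull)
      {Frd : Type} {IsoF : Frd → Frd → Type} {Ob : Frd → Type} {realify : Frd → Frd} {Strip : Type}
      {IsoS : Strip → Strip → Type}
      {Mv : ∀ v : (thetaIndex (pilotDataOfK T.D T.K)).V, v ∈ (thetaIndex (pilotDataOfK T.D T.K)).Vbad → Type}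
      [∀ v h, Monoid (Mv v h)]
      (sig : GlobalLGPFrobenioidSignature (thetaIndex (pilotDataOfK T.D T.K)).lstar (thetaIndex (pilotDataOfK T.D T.K)).V
        (· ∈ (thetaIndex (pilotDataOfK T.D T.K)).Vbad) Frd IsoF Ob realify Strip IsoS Mv)
      (split : SplittingMonoids Mv) {ObΔ : Type}
      {N : ∀ v : (thetaIndex (pilotDataOfK T.D T.K)).V, v ∈ (thetaIndex (pilotDataOfK T.D T.K)).Vbad → Type} [∀ v h, Monoid (N v h)]
      (qData : QPilotData ObΔ N)
      (ω : Fin (thetaIndex (pilotDataOfK T.D T.K)).lstar × (thetaIndex (pilotDataOfK T.D T.K)).VQ → ℝ) {B : ℝ},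
      (∀ c, ω c ≤ 1) →
      weightedDeficit
          (settingPrVolSharp (pilotDataOfK T.D T.K) (logvAnalytic_analyticLogv (F := T.K)) M archPk archSub Ψ act Mmod region n lat
            sig split qData (exists_realising_qIdeles_pilotDataOfK T.D).choose (exists_realising_thetaIdeles_pilotDataOfK T.D).choose
            (exists_realising_qIdeles_pilotDataOfK T.D).choose_spec.1 (exists_realising_qIdeles_pilotDataOfK T.D).choose_spec.2.1) ω ≤ 0 →
      T.HullEstimateOf B →
      T.gap ≤
        weightedTrivialMass
          (settingPrVolSharp (pilotDataOfK T.D T.K) (logvAnalytic_analyticLogv (F := T.K)) M archPk archSub Ψ act Mmod region n lat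
            sig split qData (exists_realising_qIdeles_pilotDataOfK T.D).choose (exists_realising_thetaIdeles_pilotDataOfK T.D).choose
            (exists_realising_qIdeles_pilotDataOfK T.D).choose_spec.1 (exists_realising_qIdeles_pilotDataOfK T.D).choose_spec.2.1) ω +
          B + ThetaVolumeInput.archLogTheta l := by
  intro M _ _ archPk archSub Ψ act Mmod region n HT LogLink IsFull lat Frd IsoF Ob realify Strip IsoS Mv _ sig split ObΔ N _ qData ω B hω hW hB
  letI := T.instFieldF; letI := T.instNumberFieldF; letI := T.instAlgebraF; letI := T.instFieldK
  letI := T.instNumberFieldK; letI := T.instAlgebraK; letI := T.instFieldFbar; letI := T.instAlgebraFbar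
  letI := T.instAlgebraKFbar; letI := T.instIsElliptic
  have h := cor312UpTo_weightedTrivialMass_of_weightedDeficit_nonpos_chosen T M archPk archSub Ψ act Mmod region n lat sig split qData ω hω hW
  have hg := RH.OffSigma.gap_le_of_cor312UpTo T (δ := B) (by linarith [h]) hB
  linarith

end Chosen

end Summit.ABC.IUTFork.Repair.RH.SigmaStrataEq

end
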